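import Summits.ValiantsHypothesis.ValiantsHypothesis.Theorems.LacunarySymmetroidMatrixDescartesDoorA26WallBubblingNewtonLift
import Summits.ValiantsHypothesis.ValiantsHypothesis.Theorems.LacunarySymmetroidMatrixDescartesDoorA26WallBubblingFirstOrderDual

/-!
# `DoorA26` / line `wall_bubbling` — FIRST-ORDER OPENING OF ANY PROFILE OF ORDER ≤ 3 (simple zeros, touches, triple zeros — any number, no frame)

HONEST FRAMING.  Object-search cell `pub-symmetroid`, crux `Theses.LacunarySymmetroid.DoorA26` (stmt-ValiantsHypothesis-19979; OPEN, typed,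
never asserted).  W2 seat val-sym-door-p1 g20, file #80; def-free helper for obligation (R) of `Cruxes/DoorA26/Lines/wall_bubbling.lean`.
Imports #79 `…NewtonLift` (the Newton-polygon lift) and #47 `…FirstOrderDual` (coordinate shift letters `!![w l 0, w l 1; w l 1, w l 2]`).

THE THEOREM (`mem_twentyLocus_of_orderThree_pushes`).  Symmetric letters `S`, `F = det P`; separated points `z_j` (`z_i + ρ ≤ z_j − ρ`) of exact orders
`m_j ∈ {1,2,3}` (`F^{(i)}(z_j) = 0` for `i < m_j`, `F^{(m_j)}(z_j) ≠ 0`), `Σ m_j ≥ 20`; a coordinate shift `w` (letters `T_l = !![w l 0, w l 1; w l 1, w l 2]`,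
pencil `Q`, first variation `c₁ = det(P+Q) − det P − det Q`) with, at every TOUCH (`m_j = 2`), the push `F″(z_j)·c₁(z_j) < 0` and, at every TRIPLE zero
(`m_j = 3`), `c₁(z_j) = 0` and the slope `F‴(z_j)·c₁′(z_j) < 0`.  Then `δ ∈ TwentyLocus`.  This is #50 (`mem_twentyLocus_of_tripleZero_deriv`: ONE triple
zero, 19-point frame) and the Q-lift of #46/#47 (touches, 21-point frame) for ANY NUMBER of triple zeros and touches at once, with NO frame and NO
encoding hypotheses: an instance of #79 with the Newton data `α = 1/2`, `β_j = m_j/2`, `k_j = (m_j, m_j − 2, 0)` and the scaling polynomials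
`aσ`, `aσ² + b`, `aσ³ + bσ` (witness tables `∓1`; `−2ρ₀, ρ₀/2, 2ρ₀`; `−2ρ₀, −ρ₀/2, ρ₀/2, 2ρ₀`, `ρ₀ = √(−b/a)`).

WHAT IS HERE.  The three witness lemmas `newtonWitness_one/two/three`; ★★ `mem_twentyLocus_of_orderThree_pushes`.  Its dual form (Rockafellar's
alternative on the subspace `{c₁(z_j) = 0 at the triple zeros}`: lift, or a generalized balance) is the next file.  Nothing here bears on `DoorA26`,
`DoorA34`, (W)/(M)/(R), `MatrixDescartes` (18050) or `VP ≠ VNP`; registers unchanged.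

[folklore] Newton polygon.  [this work] the theorem.
-/

set_option linter.dupNamespace false

namespace Summit.ValiantsHypothesis.ValiantsHypothesis.Theorems.LacunarySymmetroidMatrixDescartes.WallBubbling

open Finset Filter Topology
open Bubbling (TwentyLocus expSum)

/-! ## §1 Witness tables for the scaling polynomials `aσ`, `aσ² + b`, `aσ³ + bσ` -/

/-- Order one: `M(σ) = aσ`, `a ≠ 0`: signs `−a, a` at `σ = −1, 1`. [folklore] -/
theorem newtonWitness_one {a : ℝ} (ha : a ≠ 0) : 0 < -a * (a * (-1)) ∧ 0 < a * (a * 1) := by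
  have h := mul_self_pos.2 ha
  constructor <;> nlinarith

/-- Order two: `M(σ) = aσ² + b`, `ab < 0`, `ρ₀ = √(−b/a)`: `M(±2ρ₀) = −3b`, `M(ρ₀/2) = 3b/4`. [folklore] -/
theorem newtonWitness_two {a b : ℝ} (hab : a * b < 0) :
    0 < Real.sqrt (-b / a) ∧
    a * (-2 * Real.sqrt (-b / a)) ^ 2 + b = -3 * b ∧ a * (Real.sqrt (-b / a) / 2) ^ 2 + b = 3 / 4 * b ∧
    a * (2 * Real.sqrt (-b / a)) ^ 2 + b = -3 * b := by
  have ha : a ≠ 0 := fun h => by rw [h, zero_mul] at hab; exact lt_irrefl 0 hab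
  have hq : 0 < -b / a := by
    rcases lt_or_gt_of_ne ha with h | h
    · have hb : 0 < b := by nlinarith
      exact div_pos_of_neg_of_neg (by linarith) h
    · have hb : b < 0 := by nlinarith
      exact div_pos (by linarith) h
  have hsq : Real.sqrt (-b / a) ^ 2 = -b / a := Real.sq_sqrt hq.le
  refine ⟨Real.sqrt_pos.2 hq, ?_, ?_, ?_⟩
  · rw [mul_pow, hsq]; field_simp; ring
  · rw [div_pow, hsq]; field_simp; ring
  · rw [mul_pow, hsq]; field_simp; ring

/-- Order three: `M(σ) = aσ³ + bσ = σ(aσ² + b)`, `ab < 0`, `ρ₀ = √(−b/a)`: the four values at `∓2ρ₀, ∓ρ₀/2`. [folklore] -/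
theorem newtonWitness_three {a b : ℝ} (hab : a * b < 0) :
    0 < Real.sqrt (-b / a) ∧
    a * (-2 * Real.sqrt (-b / a)) ^ 3 + b * (-2 * Real.sqrt (-b / a)) = 6 * b * Real.sqrt (-b / a) ∧
    a * (-(Real.sqrt (-b / a) / 2)) ^ 3 + b * (-(Real.sqrt (-b / a) / 2)) = -(3 / 8) * b * Real.sqrt (-b / a) ∧
    a * (Real.sqrt (-b / a) / 2) ^ 3 + b * (Real.sqrt (-b / a) / 2) = 3 / 8 * b * Real.sqrt (-b / a) ∧
    a * (2 * Real.sqrt (-b / a)) ^ 3 + b * (2 * Real.sqrt (-b / a)) = -(6 * b * Real.sqrt (-b / a)) := by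
  obtain ⟨hpos, h1, h2, h3⟩ := newtonWitness_two hab
  set q := Real.sqrt (-b / a) with hq
  refine ⟨hpos, ?_, ?_, ?_, ?_⟩
  · have : a * (-2 * q) ^ 3 + b * (-2 * q) = (-2 * q) * (a * (-2 * q) ^ 2 + b) := by ring
    rw [this, h1]; ring
  · have : a * (-(q / 2)) ^ 3 + b * (-(q / 2)) = -(q / 2) * (a * (q / 2) ^ 2 + b) := by ring
    rw [this, h2]; ring
  · have : a * (q / 2) ^ 3 + b * (q / 2) = (q / 2) * (a * (q / 2) ^ 2 + b) := by ring
    rw [this, h2]; ring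
  · have : a * (2 * q) ^ 3 + b * (2 * q) = (2 * q) * (a * (2 * q) ^ 2 + b) := by ring
    rw [this, h3]; ring

/-! ## §2 The theorem -/

/-- ★★ **FIRST-ORDER OPENING OF A PROFILE OF ORDER ≤ 3** (see the module docstring).  Simple zeros need nothing, touches a push of sign `−F″(z_j)`,
triple zeros the value `c₁(z_j) = 0` and a slope of sign `−F‴(z_j)`; any number of each; conclusion `δ ∈ TwentyLocus`. [this work] -/
theorem mem_twentyLocus_of_orderThree_pushes (δ : Fin 6 → ℝ) (S : Fin 6 → Matrix (Fin 2) (Fin 2) ℝ) (hS : ∀ l, (S l).IsSymm)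
    {r : ℕ} (z : Fin r → ℝ) {ρ : ℝ} (hρ : 0 < ρ) (hsep : ∀ i j : Fin r, i < j → z i + ρ ≤ z j - ρ)
    (m : Fin r → ℕ) (hm1 : ∀ j, 1 ≤ m j) (hm3 : ∀ j, m j ≤ 3) (hm : 20 ≤ ∑ j, m j)
    (hvan : ∀ j, ∀ i < m j, iteratedDeriv i (fun t => (∑ l, Real.exp (δ l * t) • S l).det) (z j) = 0)
    (htop : ∀ j, iteratedDeriv (m j) (fun t => (∑ l, Real.exp (δ l * t) • S l).det) (z j) ≠ 0)
    (w : Fin 6 → Fin 3 → ℝ)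
    (htouch : ∀ j, m j = 2 → iteratedDeriv 2 (fun t => (∑ l, Real.exp (δ l * t) • S l).det) (z j) *
      (((∑ l, Real.exp (δ l * z j) • S l) + (∑ l, Real.exp (δ l * z j) • (!![w l 0, w l 1; w l 1, w l 2] : Matrix (Fin 2) (Fin 2) ℝ))).det
        - (∑ l, Real.exp (δ l * z j) • S l).det
        - (∑ l, Real.exp (δ l * z j) • (!![w l 0, w l 1; w l 1, w l 2] : Matrix (Fin 2) (Fin 2) ℝ)).det) < 0)
    (htriple0 : ∀ j, m j = 3 →
      (((∑ l, Real.exp (δ l * z j) • S l) + (∑ l, Real.exp (δ l * z j) • (!![w l 0, w l 1; w l 1, w l 2] : Matrix (Fin 2) (Fin 2) ℝ))).det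
        - (∑ l, Real.exp (δ l * z j) • S l).det
        - (∑ l, Real.exp (δ l * z j) • (!![w l 0, w l 1; w l 1, w l 2] : Matrix (Fin 2) (Fin 2) ℝ)).det) = 0)
    (htriple1 : ∀ j, m j = 3 → iteratedDeriv 3 (fun t => (∑ l, Real.exp (δ l * t) • S l).det) (z j) *
      deriv (fun t => ((∑ l, Real.exp (δ l * t) • S l) + (∑ l, Real.exp (δ l * t) • (!![w l 0, w l 1; w l 1, w l 2] : Matrix (Fin 2) (Fin 2) ℝ))).det
        - (∑ l, Real.exp (δ l * t) • S l).det
        - (∑ l, Real.exp (δ l * t) • (!![w l 0, w l 1; w l 1, w l 2] : Matrix (Fin 2) (Fin 2) ℝ)).det) (z j) < 0) :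
    δ ∈ TwentyLocus := by
  classical
  -- the shift letters and the three coefficient functions
  set T : Fin 6 → Matrix (Fin 2) (Fin 2) ℝ := fun l => !![w l 0, w l 1; w l 1, w l 2] with hT
  have hTs : ∀ l, (T l).IsSymm := fun l => isSymm_coordLetter w l
  set c₀ : ℝ → ℝ := fun t => (∑ l, Real.exp (δ l * t) • S l).det with hc₀
  set c₁ : ℝ → ℝ := fun t => ((∑ l, Real.exp (δ l * t) • S l) + (∑ l, Real.exp (δ l * t) • T l)).det
        - (∑ l, Real.exp (δ l * t) • S l).det - (∑ l, Real.exp (δ l * t) • T l).det with hc₁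
  set c₂ : ℝ → ℝ := fun t => (∑ l, Real.exp (δ l * t) • T l).det with hc₂
  -- per-zero data: `a_j = F^{(m)}(z_j)/m!`, `b_j = c₁^{(m−2)}(z_j)/(m−2)!`
  let A : Fin r → ℝ := fun j => iteratedDeriv (m j) c₀ (z j) / (m j).factorial
  let B : Fin r → ℝ := fun j => iteratedDeriv (m j - 2) c₁ (z j) / (m j - 2).factorial
  -- scale and tables
  let scale : Fin r → ℝ := fun j => if m j = 1 then 1 else Real.sqrt (-B j / A j)
  let W : ℕ → ℕ → ℝ := fun n i =>
    if n = 1 then (if i = 0 then -1 else 1)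
    else if n = 2 then (if i = 0 then -2 else if i = 1 then 1 / 2 else 2)
    else (if i = 0 then -2 else if i = 1 then -(1 / 2) else if i = 2 then 1 / 2 else 2)
  let E : Fin r → ℝ := fun j => if m j = 1 then -A j else if m j = 2 then -B j else B j
  let σ : (j : Fin r) → Fin (m j + 1) → ℝ := fun j i => scale j * W (m j) i.val
  let ε : (j : Fin r) → Fin (m j + 1) → ℝ := fun j i => (-1) ^ i.val * E j
  -- basic facts per order
  have hA : ∀ j, A j ≠ 0 := fun j => div_ne_zero (htop j) (Nat.cast_ne_zero.2 (Nat.factorial_ne_zero _))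
  have hAB2 : ∀ j, m j = 2 → A j * B j < 0 := by
    intro j hj
    have h := htouch j hj
    have hA' : A j = iteratedDeriv 2 c₀ (z j) / 2 := by
      show iteratedDeriv (m j) c₀ (z j) / (m j).factorial = _
      rw [hj]; norm_num [Nat.factorial]
    have hB' : B j = c₁ (z j) := by
      show iteratedDeriv (m j - 2) c₁ (z j) / (m j - 2).factorial = _
      rw [hj]; simp
    rw [hA', hB']
    have : iteratedDeriv 2 c₀ (z j) * c₁ (z j) < 0 := h
    nlinarith
  have hAB3 : ∀ j, m j = 3 → A j * B j < 0 := by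
    intro j hj
    have h := htriple1 j hj
    have hA' : A j = iteratedDeriv 3 c₀ (z j) / 6 := by
      show iteratedDeriv (m j) c₀ (z j) / (m j).factorial = _
      rw [hj]; norm_num [Nat.factorial]
    have hB' : B j = deriv c₁ (z j) := by
      show iteratedDeriv (m j - 2) c₁ (z j) / (m j - 2).factorial = _
      rw [hj]; simp
    rw [hA', hB']
    have : iteratedDeriv 3 c₀ (z j) * deriv c₁ (z j) < 0 := h
    nlinarith
  have hscale : ∀ j, 0 < scale j := by
    intro j
    by_cases h1 : m j = 1
    · simp only [scale, h1, if_true]; exact one_pos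
    · simp only [scale, h1, if_false]
      rcases (by have := hm1 j; have := hm3 j; omega : m j = 2 ∨ m j = 3) with h | h
      · exact (newtonWitness_two (hAB2 j h)).1
      · exact (newtonWitness_two (hAB3 j h)).1
  have hE : ∀ j, E j ≠ 0 := by
    intro j
    by_cases h1 : m j = 1
    · simp only [E, h1, if_true]; exact neg_ne_zero.2 (hA j)
    · rcases (by have := hm1 j; have := hm3 j; omega : m j = 2 ∨ m j = 3) with h | h
      · simp only [E, h, if_true, show (2 : ℕ) ≠ 1 by norm_num, if_false]
        have := hAB2 j h
        exact neg_ne_zero.2 fun hb => by rw [hb, mul_zero] at this; exact lt_irrefl 0 this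
      · simp only [E, h, show (3 : ℕ) ≠ 1 by norm_num, show (3 : ℕ) ≠ 2 by norm_num, if_false]
        have := hAB3 j h
        exact fun hb => by rw [hb, mul_zero] at this; exact lt_irrefl 0 this
  -- monotone non-zero tables
  have hWmono : ∀ n, 1 ≤ n → n ≤ 3 → ∀ i, i < n → W n i < W n (i + 1) := by
    intro n h1 h3 i hi
    interval_cases n <;> interval_cases i <;> norm_num [W]
  have hW0 : ∀ n, 1 ≤ n → n ≤ 3 → ∀ i, i ≤ n → W n i ≠ 0 := by
    intro n h1 h3 i hi
    interval_cases n <;> interval_cases i <;> norm_num [W]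
  refine mem_twentyLocus_of_newton_openings_linear δ S T hS hTs z hρ hsep m hm (fun _ => 1 / 2) (fun _ => by norm_num)
    (fun j => (m j : ℝ) / 2) (fun j => ![m j, m j - 2, 0]) ?_ ?_ σ ?_ ?_ ε ?_ ?_
  · -- vanishing below the orders
    intro j n i hi
    fin_cases n
    · change i < m j at hi
      change iteratedDeriv i c₀ (z j) = 0
      exact hvan j i hi
    · change i < m j - 2 at hi
      change iteratedDeriv i c₁ (z j) = 0
      have hm3j : m j = 3 := by have := hm3 j; omega
      have hi0 : i = 0 := by omega
      subst hi0
      rw [iteratedDeriv_zero]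
      exact htriple0 j hm3j
    · change i < 0 at hi
      exact absurd hi (Nat.not_lt_zero i)
  · -- the weights `β_j ≤ n + k/2`
    intro j n
    have h1 := hm1 j; have h3 := hm3 j
    fin_cases n
    · change (m j : ℝ) / 2 ≤ ((0 : ℕ) : ℝ) + 1 / 2 * ((m j : ℕ) : ℝ)
      push_cast; linarith
    · change (m j : ℝ) / 2 ≤ ((1 : ℕ) : ℝ) + 1 / 2 * ((m j - 2 : ℕ) : ℝ)
      rcases (by omega : m j = 1 ∨ m j = 2 ∨ m j = 3) with h | h | h <;> rw [h] <;> norm_num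
    · change (m j : ℝ) / 2 ≤ ((2 : ℕ) : ℝ) + 1 / 2 * ((0 : ℕ) : ℝ)
      have : (m j : ℝ) ≤ 3 := by exact_mod_cast h3
      push_cast; linarith
  · -- the abscissa tables are increasing
    intro j
    refine Fin.strictMono_iff_lt_succ.2 fun i => ?_
    show scale j * W (m j) i.castSucc.val < scale j * W (m j) i.succ.val
    rw [Fin.val_succ, Fin.val_castSucc]
    exact mul_lt_mul_of_pos_left (hWmono (m j) (hm1 j) (hm3 j) i.val i.isLt) (hscale j)
  · -- and non-zero
    intro j i
    exact mul_ne_zero (hscale j).ne' (hW0 (m j) (hm1 j) (hm3 j) i.val (Nat.lt_succ_iff.1 i.isLt))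
  · -- alternating signs
    intro j i
    show ((-1) ^ i.castSucc.val * E j) * ((-1) ^ i.succ.val * E j) < 0
    rw [Fin.val_succ, Fin.val_castSucc, pow_succ]
    have hE2 : 0 < E j * E j := mul_self_pos.2 (hE j)
    have hp : ((-1 : ℝ) ^ (i : ℕ)) * ((-1 : ℝ) ^ (i : ℕ)) = 1 := by
      rw [← mul_pow]; norm_num
    nlinarith [hp, hE2]
  · -- the scaling polynomials at the witnesses
    intro j i
    -- reduce to the natural index
    have hi : i.val ≤ m j := Nat.lt_succ_iff.1 i.isLt
    show 0 < ((-1) ^ i.val * E j) * ∑ n : Fin 3, (if ((n : ℕ) : ℝ) + 1 / 2 * ((![m j, m j - 2, 0] : Fin 3 → ℕ) n : ℝ) = (m j : ℝ) / 2 then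
        iteratedDeriv ((![m j, m j - 2, 0] : Fin 3 → ℕ) n) ((![c₀, c₁, c₂] : Fin 3 → ℝ → ℝ) n) (z j)
          / (((![m j, m j - 2, 0] : Fin 3 → ℕ) n).factorial : ℝ) * (scale j * W (m j) i.val) ^ ((![m j, m j - 2, 0] : Fin 3 → ℕ) n) else 0)
    generalize hii : i.val = ii at hi ⊢
    simp only [Fin.sum_univ_three, Matrix.cons_val_zero, Matrix.cons_val_one, Matrix.head_cons, Matrix.cons_val_two, Matrix.tail_cons,
      Fin.val_zero, Fin.val_one, Fin.val_two, Nat.cast_zero, Nat.cast_one]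
    rcases (by have := hm1 j; have := hm3 j; omega : m j = 1 ∨ m j = 2 ∨ m j = 3) with h | h | h
    · -- order one: `M(σ) = aσ`
      have hA1 : deriv c₀ (z j) = A j := by
        show _ = iteratedDeriv (m j) c₀ (z j) / ((m j).factorial : ℝ); rw [h]; simp
      have hsc : scale j = 1 := by simp only [scale, h, if_true]
      have hEj : E j = -A j := by simp only [E, h, if_true]
      rw [h] at hi ⊢
      simp only [show (1 : ℕ) - 2 = 0 from rfl, hsc, one_mul, hEj]
      norm_num
      rw [hA1]
      obtain ⟨w0, w1⟩ := newtonWitness_one (hA j)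
      interval_cases ii <;> norm_num [W] <;> nlinarith [w0, w1]
    · -- order two: `M(σ) = aσ² + b`
      have hA2 : iteratedDeriv 2 c₀ (z j) / ((2 : ℕ).factorial : ℝ) = A j := by
        show _ = iteratedDeriv (m j) c₀ (z j) / (m j).factorial; rw [h]
      have hB2 : iteratedDeriv 0 c₁ (z j) / ((0 : ℕ).factorial : ℝ) = B j := by
        show _ = iteratedDeriv (m j - 2) c₁ (z j) / (m j - 2).factorial; rw [h]
      have hsc : scale j = Real.sqrt (-B j / A j) := by simp only [scale, h, show (2 : ℕ) ≠ 1 by norm_num, if_false]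
      have hEj : E j = -B j := by simp only [E, h, show (2 : ℕ) ≠ 1 by norm_num, if_false, if_true]
      rw [h] at hi ⊢
      simp only [show (2 : ℕ) - 2 = 0 from rfl, hsc, hEj]
      norm_num
      rw [show iteratedDeriv 2 c₀ (z j) / 2 = A j by simpa [Nat.factorial] using hA2,
        show c₁ (z j) = B j by simpa using hB2]
      have hq : 0 < Real.sqrt (-B j / A j) := (newtonWitness_two (hAB2 j h)).1
      have hq2 : A j * Real.sqrt (-B j / A j) ^ 2 = -B j := by
        rw [Real.sq_sqrt (Real.sqrt_pos.1 hq).le]; field_simp [hA j]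
      have hB : B j ≠ 0 := fun hb => by have := hAB2 j h; rw [hb, mul_zero] at this; exact lt_irrefl 0 this
      have hBB : 0 < B j * B j := mul_self_pos.2 hB
      set s := Real.sqrt (-B j / A j) with hs
      interval_cases ii <;> norm_num [W]
      · have e : A j * (s * 2) ^ 2 + B j = -3 * B j := by linear_combination (4 : ℝ) * hq2
        rw [e]; nlinarith
      · have e : A j * (s * (1 / 2)) ^ 2 + B j = 3 / 4 * B j := by linear_combination (1 / 4 : ℝ) * hq2
        rw [e]; nlinarith
      · have e : A j * (s * 2) ^ 2 + B j = -3 * B j := by linear_combination (4 : ℝ) * hq2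
        rw [e]; nlinarith
    · -- order three: `M(σ) = aσ³ + bσ`
      have hA3 : iteratedDeriv 3 c₀ (z j) / ((3 : ℕ).factorial : ℝ) = A j := by
        show _ = iteratedDeriv (m j) c₀ (z j) / (m j).factorial; rw [h]
      have hB3 : deriv c₁ (z j) = B j := by
        show _ = iteratedDeriv (m j - 2) c₁ (z j) / ((m j - 2).factorial : ℝ); rw [h]; simp
      have hsc : scale j = Real.sqrt (-B j / A j) := by simp only [scale, h, show (3 : ℕ) ≠ 1 by norm_num, if_false]
      have hEj : E j = B j := by
        simp only [E, h, show (3 : ℕ) ≠ 1 by norm_num, show (3 : ℕ) ≠ 2 by norm_num, if_false]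
      rw [h] at hi ⊢
      simp only [show (3 : ℕ) - 2 = 1 from rfl, hsc, hEj]
      norm_num
      rw [show iteratedDeriv 3 c₀ (z j) / 6 = A j by simpa [Nat.factorial] using hA3, hB3]
      have hq : 0 < Real.sqrt (-B j / A j) := (newtonWitness_two (hAB3 j h)).1
      have hq2 : A j * Real.sqrt (-B j / A j) ^ 2 = -B j := by
        rw [Real.sq_sqrt (Real.sqrt_pos.1 hq).le]; field_simp [hA j]
      have hB : B j ≠ 0 := fun hb => by have := hAB3 j h; rw [hb, mul_zero] at this; exact lt_irrefl 0 this
      have hBB : 0 < B j * B j := mul_self_pos.2 hB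
      set s := Real.sqrt (-B j / A j) with hs
      have hsBB : 0 < s * (B j * B j) := mul_pos hq hBB
      interval_cases ii <;> norm_num [W]
      · have e : A j * (-(s * 2)) ^ 3 + -(B j * (s * 2)) = 6 * s * B j := by linear_combination (-8 * s) * hq2
        rw [e]; nlinarith
      · have e : A j * (-(s * (1 / 2))) ^ 3 + -(B j * (s * (1 / 2))) = -(3 / 8) * s * B j := by
          linear_combination (-s / 8) * hq2
        rw [e]; nlinarith
      · have e : A j * (s * (1 / 2)) ^ 3 + B j * (s * (1 / 2)) = 3 / 8 * s * B j := by linear_combination (s / 8) * hq2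
        rw [e]; nlinarith
      · have e : A j * (s * 2) ^ 3 + B j * (s * 2) = -6 * s * B j := by linear_combination (8 * s) * hq2
        rw [e]; nlinarith

end Summit.ValiantsHypothesis.ValiantsHypothesis.Theorems.LacunarySymmetroidMatrixDescartes.WallBubbling
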